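import Summits.QuantumFields.YangMills.Theorems.BalabanLadderNTSubsequentialGrowth
import Summits.QuantumFields.YangMills.Theorems.BalabanLadderIRCofinalCouplingsBridge
import HarnessLib

/-!
# Crux `NT` (stmt-QuantumFields-19353): the summit bridge consumes `NT` ONLY SUBSEQUENTIALLY —
# `YangMills ⇐ UV ∧ ROT ∧` (IR and NT's two floors on a cofinal set of couplings, the floors on tori of unbounded size)

Helper file (`--supports stmt-QuantumFields-19353`) of the fleet lead prover of crux `NT` (unit `ym-spine-19353-p1`, g29),
hypothesis-free; sequel of `…NTSubsequentialNontrivial` (toolkit XI-b in sequence form) and `…NTSubsequentialGrowth` (the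
soft bundle with NT-chosen tori).  HONEST FRAMING: every binder is a HYPOTHESIS about lattice Yang–Mills taken from the tree;
nothing here proves `NT`, a floor, the gap, or the Clay statement `YangMills` (R4 closes only the finite-𝕋⁴ rung `UV`).

WHAT (the «weakest consequence of NT that still decides the summit», the lens the IR desk ran on `IR` in
`Theorems/BalabanLadderIRCofinalCouplings*.lean`, now run on `NT`).  The leaf `BalabanLadder.NT` asks, for SOME `(r, a)`, the
k-free floors `LowerBounds G r a`: (i) `ε ≤ Q2 G r β L (a β) (θv) v` and (ii) `ε' ≤ |Q3 G r β L (a β) f g h|` at EVERY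
coupling `β ≥ β₅` on EVERY torus `2L+1` with `Λ₅ ≤ a β · L`.  The deciding bridge `Y2Bridge.yangMills_of_legs` uses them at
ONE place (toolkit XV/XI-b: the scheme it extracts).  Hence:

* §1 `osDataWithGap_of_legs_germ_subseqNT`, `osDataWithGap_of_subseqNTLegs` — OS data that IS Yang–Mills for `r` along a
  scheme in units `a`, non-trivial, non-Gaussian, with both gaps, from `UV = MomentBounds6`, ANY germ mechanism (resp. `ROT`),
  and, on ONE cofinal coupling set `Bset`, the `GapInUnits` family (IR) together with NT's SUBSEQUENTIAL floors: one
  positive-time `v`, `ε > 0`, pairwise-disjointly supported `f, g, h`, `ε' > 0`, and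
  `∀ β ∈ Bset, ∀ D, ∃ L ≥ D, ε ≤ Q2 G r β L (a β) (θv) v ∧ ε' ≤ |Q3 G r β L (a β) f g h|`;
* §1 **`yangMills_of_subseqNTLegs`** — `(∀ G simple, ∃ r a, a > 0 ∧ a → 0 ∧ UV ∧ ROT ∧ ∃ Bset cofinal, IR on Bset ∧ NT's
  subsequential floors on Bset) → YangMills` (the tree's `_root_.YangMills` literally);
* §2 the NT-side dictionary: `subseqFloors_of_lowerBounds` (the typed leaf gives the subsequential floors on
  `Bset = [max β₅ β₆, ∞)`, so `yangMills_of_legs` / `yangMills_of_cofinalLegs` are special cases — `yangMills_of_legs_via_subseq`);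
  `exists_cofinal_unbounded_iff_forall_demand` (set-free reading: «for every threshold `B` and every volume demand
  `D : ℝ → ℕ` some coupling `β ≥ B` and some torus `L ≥ D β` carry the property»); `forall_demand_or` (STABILITY UNDER
  POINTWISE DISJUNCTION: if at every large enough `(β, L)` property `P` OR property `Q` holds in this sense, then `P` alone or
  `Q` alone holds in this sense — false for the typed `∀β ∀L` form); `subseq_of_thresholds` (per-coupling volume thresholds
  suffice), `subseq_of_seq` (tuned sequences of couplings suffice), `subseq_of_window_uniform` / `not_subseq_of_octaveShape`
  (coupling windows feed the form iff the selected coupling is torus-uniform).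

WHY IT MATTERS FOR 19353 (numbers, not adjectives).  Relative to the typed leaf the bridge's actual demand drops TWO universal
quantifiers: «all couplings `β ≥ β₅`» ↦ «a cofinal set of couplings» and «all tori `L ≥ Λ₅/a β`» ↦ «infinitely many tori,
chosen per coupling» (the set-free reading asks, for every threshold `B` and every volume demand `D : ℝ → ℕ`, ONE admissible
pair `β ≥ B`, `L ≥ D β`).  What the weak form admits that the typed one does not: floors proved only on special torus sizes
(odd sides, doubling chains `L₀·2^m`, chessboard divisibility), per-coupling volume thresholds with no uniformity in `β`
(`subseq_of_thresholds`), floors along a TUNED SEQUENCE of bare couplings (`subseq_of_seq` — how a multiscale engine delivers,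
cf. `GapInUnitsSeq` in `Y2BridgeClay`), and pointwise disjunctions over finitely many candidate test functions / channels
(`forall_demand_or`).  What it does NOT admit (`not_subseq_of_octaveShape`): coupling WINDOWS whose selected coupling depends
on the torus — the shape `∀ L, ∀ β, ∃ γ ∈ [β, Mβ]` of the tree's k = 0 octave laws `…NTCouplingSumRuleOctaves` — unless the
selection is torus-uniform (`subseq_of_window_uniform`).  Re-typing the leaf is the route owner's decision (as R423/R424 did
for `IR ↦ IRcof`); this file only certifies that the subsequential leaf closes the summit with the other legs unchanged.

References: K. Osterwalder, E. Seiler, Ann. Phys. 110 (1978) 440–471; J. Glimm, A. Jaffe, *Quantum Physics* (1987) §6.1,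
§19.7; A. Jaffe, E. Witten (2006) §5–§6; the tree files above. [folklore]
-/

set_option autoImplicit false

noncomputable section

open scoped SchwartzMap ComplexConjugate BigOperators
open MeasureTheory Filter Topology
open Literature.MathematicalPhysics.QuantumFieldTheory Literature.MathematicalPhysics.QuantumLattice
open Literature.MathematicalPhysics.AQFT Literature.Probability.LatticeModels
open Summit.QuantumFields.YangMills.Cruxes.OSLegsFromFemtoAndGap.DlrCollarTransfer
open Summit.QuantumFields.YangMills.Cruxes.OSLegsAtWeakCouplingC.Sketch
open Summit.QuantumFields.YangMills.Theorems.OSLegsFromFemtoAndGap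
  (isHermitian_of_isReflectionPositive latticeDist softLegs_joint_growth_subseq)
open Summit.QuantumFields.YangMills.Theorems.HypercubicLimit.Negative (onlySpecies latticeSchwinger_onlySpecies_self)
open Summit.QuantumFields.YangMills.Theorems.NPointIsotropy.Negative (E4)

namespace Summit.QuantumFields.YangMills.Cruxes.OSLegsAtWeakCouplingC.Y2Bridge

/-! ## §1 The bridge at one gauge group and the Clay decl, NT consumed subsequentially -/

section OneGroup

variable {G : Type} [Group G] [TopologicalSpace G] [IsTopologicalGroup G] [CompactSpace G]
  [MeasurableSpace G] [BorelSpace G]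

/-- **OS data with BOTH gaps from `UV`, NT's SUBSEQUENTIAL floors and IR on one cofinal coupling set, and ANY germ
mechanism** (any compact `G`, any `r`, any positive unit map `a → 0`).  The tree's `osDataWithGap_of_legs_germ` verbatim
except that the rope is the IR desk's `stub_rope_onCouplings` and the soft bundle is `softLegs_joint_growth_subseq`
(couplings in `Bset`, tori chosen where NT's two floors hold). [folklore] -/
theorem osDataWithGap_of_legs_germ_subseqNT (r : LatticeRep G) (a : ℝ → ℝ) (hapos : ∀ β, 0 < a β)
    (ha0 : Tendsto a atTop (𝓝 0)) (hUV : UV G r a)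
    (Bset : Set ℝ) (hBcof : ∀ x : ℝ, ∃ β ∈ Bset, x ≤ β)
    (hNTsub : ∃ (v : 𝓢(E4, ℝ)) (ε : ℝ) (f g h : 𝓢(E4, ℝ)) (ε' : ℝ),
      tsupport (v : E4 → ℝ) ⊆ {y : E4 | 0 < y 0} ∧ 0 < ε ∧
      Disjoint (tsupport f) (tsupport g) ∧ Disjoint (tsupport g) (tsupport h) ∧ Disjoint (tsupport f) (tsupport h) ∧
      0 < ε' ∧ ∀ β ∈ Bset, ∀ D : ℕ, ∃ L : ℕ, D ≤ L ∧
        ε ≤ Q2 G r β L (a β) (thetaTest 4 v) v ∧ ε' ≤ |Q3 G r β L (a β) f g h|)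
    (hIRon : ∃ (c₁ β₂ : ℝ) (S₁ : ℝ → ℕ), 0 < c₁ ∧ ∀ A B : YMSpecies G, ∃ C : ℝ, ∀ β ∈ Bset, β₂ ≤ β →
      ∀ S n : ℕ, S₁ β ≤ S → n ≤ S →
        |latticeConnectedCorr r.ρ β (2 * S + 1) A.F B.F n| ≤ C * Real.exp (-(c₁ * a β * n)))
    (hGERM : ∀ (sch : SpeciesScheme (YMSpecies G)) (S₁ : SchwingerFamily E4)
      (Tq : (n : ℕ) → (Fin n → Fin 4 × Fin 4) → (𝓢((Fin n → E4), ℂ) →L[ℂ] ℂ)) (K b₀ : ℝ) (g : ℝ → ℕ → ℕ),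
      SoftBundle G r a sch S₁ Tq K b₀ g → OffDiagDensity S₁ →
        ∃ r₁ : ℝ, 0 < r₁ ∧ ∀ R : E4 ≃ₗᵢ[ℝ] E4, LinearMap.det (R.toLinearEquiv : E4 →ₗ[ℝ] E4) = 1 →
          IsPlanar01 R → GermInvariant S₁ R r₁) :
    ∃ (sch : SpeciesScheme (YMSpecies G)) (T : OSData (YMSpecies G) 4),
      (∀ k, sch.a k = a (sch.β k)) ∧ sch.HasWeakCouplingLimit ∧ IsYangMillsFor r sch T ∧
        T.IsNontrivial r.curvature ∧ T.IsNonGaussian r.curvature ∧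
        ∃ Δ > 0, T.HasMassGap Δ ∧ HasLatticeMassGap r sch Δ := by
  -- the rope's demands (anchor read on `Bset` only), then the soft bundle meeting them WITH COUPLINGS IN `Bset`
  -- and tori chosen where NT's two floors hold
  obtain ⟨b₀, g, Δ, hΔ, hRD⟩ := stub_rope_onCouplings r a hapos ha0 Bset hIRon
  obtain ⟨sch, S₁, Tq, K, hB, hmem⟩ :=
    softLegs_joint_growth_subseq r hapos ha0 hUV Bset hBcof hNTsub hIRon b₀ g
  obtain ⟨hRP, hDec⟩ := hRD sch S₁ Tq K hB hmem
  have hsigned : ∀ R : E4 ≃ₗᵢ[ℝ] E4, IsSignedPerm R → Invariant S₁ R :=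
    fun R hR n F hF => stub_hypercubic G r a sch S₁ Tq K b₀ g hB n R hR F hF
  have hdens : OffDiagDensity S₁ := stub_density G r a sch S₁ Tq K b₀ g hUV hB
  -- unpack the bundle
  obtain ⟨⟨hunits, -, -, hβ, hN, hLG, hE3, htrans, h0, h1', -, -, hYM, hnt, hng, ⟨Δ', hΔ', hlat⟩, hranges, -⟩, -⟩ :=
    id hB
  -- E1: det-1 planar germ invariance (from the abstract mechanism) ⇒ planar invariance ⇒ SO(4)
  obtain ⟨r₁, hr₁, hgermR⟩ := hGERM sch S₁ Tq K b₀ g hB hdens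
  -- continuum side
  obtain ⟨hCS, hgapOf⟩ := stub_gap S₁ h0 htrans hRP
  have hE4 : S₁.toLabelled.HasClusterProperty :=
    stub_cluster S₁ Δ hΔ h0 h1' htrans (fun n R hR F hF => hsigned R hR n F hF) hCS hDec
  have hplanar : ∀ R : E4 ≃ₗᵢ[ℝ] E4, LinearMap.det (R.toLinearEquiv : E4 →ₗ[ℝ] E4) = 1 → IsPlanar01 R →
      Invariant S₁ R := fun R hdet hR =>
    stub_locality S₁ h0 htrans hE3 hLG hRP hsigned hdens R hR r₁ hr₁ (hgermR R hdet hR)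
  have hE1 : S₁.toLabelled.IsEuclideanInvariant := isEuclideanInvariant_of_planarRot S₁ htrans hsigned hplanar
  have hE2 : S₁.toLabelled.IsReflectionPositive := isReflectionPositive_of_rpPos hRP
  have hherm : S₁.toLabelled.IsHermitian := isHermitian_of_isReflectionPositive S₁ hN hE2
  have hOS : OSAxiomsSchwinger S₁.toLabelled :=
    { normalized := hN, hermitian := hherm, invariant := hE1, reflectionPositive := hE2, symmetric := hE3,
      cluster := hE4, linearGrowth := hLG }
  -- the continuum gap the tree derives and drops, and the common rate
  have hgap : S₁.toLabelled.HasMassGap Δ := hgapOf Δ hΔ hDec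
  have hΔ₀ : 0 < min Δ Δ' := lt_min hΔ hΔ'
  have hgap₀ : S₁.toLabelled.HasMassGap (min Δ Δ') := hasMassGap_anti hgap (min_le_left _ _)
  have hlat₀ : HasLatticeMassGap r sch (min Δ Δ') := hasLatticeMassGap_anti r sch hlat (min_le_right _ _)
  -- one OS field (species `Unit`), then extension by zero along the silenced scheme
  have hc : ∀ s : YMSpecies G, s ≠ r.curvature → ∀ k, (onlySpecies sch r.curvature).c s k = 0 := by
    intro s hs k
    simp [onlySpecies, hs]
  have hconv : ∀ n : ℕ, n ≠ 0 → ∀ (f : Fin n → 𝓢(E4, ℝ)) (F : 𝓢((Fin n → E4), ℂ)),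
      IsTensorOf F (fun i => ofRealTest (f i)) → IsOffDiagonal F →
        Tendsto (fun k : ℕ => ((latticeSchwinger r.ρ (onlySpecies sch r.curvature) (fun s => s.F) k n
          (fun _ => r.curvature) f : ℝ) : ℂ)) atTop
          (𝓝 ((OSData.ofAxioms S₁.toLabelled hOS).schwinger n (fun _ => ()) F)) := by
    intro n hn f F hF hod
    simp_rw [latticeSchwinger_onlySpecies_self]
    rw [OSData.ofAxioms_schwinger, SchwingerFamily.toLabelled_apply]
    exact hYM n hn f F hF hod
  have hNT' : (OSData.ofAxioms S₁.toLabelled hOS).IsNontrivial () := by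
    unfold OSData.IsNontrivial
    simpa only [OSData.ofAxioms_schwinger] using hnt
  have hNG' : (OSData.ofAxioms S₁.toLabelled hOS).IsNonGaussian () := by
    unfold OSData.IsNonGaussian
    simpa only [OSData.ofAxioms_schwinger] using hng
  have hgapT : (OSData.ofAxioms S₁.toLabelled hOS).HasMassGap (min Δ Δ') := by
    unfold OSData.HasMassGap
    simpa only [OSData.ofAxioms_schwinger] using hgap₀
  obtain ⟨T, hYM', hntT, hngT, Δ₁, hΔ₁, hgapT', hlatT⟩ :=
    exists_yangMillsWitness_of_oneSpecies r (onlySpecies sch r.curvature) hc (OSData.ofAxioms S₁.toLabelled hOS)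
      hconv hNT' hNG' hΔ₀ hgapT hlat₀
  exact ⟨onlySpecies sch r.curvature, T, hunits, hβ, hYM', hntT, hngT, Δ₁, hΔ₁, hgapT', hlatT⟩

/-- **OS data with BOTH gaps from `UV ∧ ROT ∧` (IR and NT's subsequential floors on one cofinal coupling set).**
(Lattice rotation-Ward form of E1: `germRotAt_of_latticeWardAt`.) [folklore] -/
theorem osDataWithGap_of_subseqNTLegs (r : LatticeRep G) (a : ℝ → ℝ) (hapos : ∀ β, 0 < a β)
    (ha0 : Tendsto a atTop (𝓝 0)) (hUV : UV G r a)
    (Bset : Set ℝ) (hBcof : ∀ x : ℝ, ∃ β ∈ Bset, x ≤ β)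
    (hNTsub : ∃ (v : 𝓢(E4, ℝ)) (ε : ℝ) (f g h : 𝓢(E4, ℝ)) (ε' : ℝ),
      tsupport (v : E4 → ℝ) ⊆ {y : E4 | 0 < y 0} ∧ 0 < ε ∧
      Disjoint (tsupport f) (tsupport g) ∧ Disjoint (tsupport g) (tsupport h) ∧ Disjoint (tsupport f) (tsupport h) ∧
      0 < ε' ∧ ∀ β ∈ Bset, ∀ D : ℕ, ∃ L : ℕ, D ≤ L ∧
        ε ≤ Q2 G r β L (a β) (thetaTest 4 v) v ∧ ε' ≤ |Q3 G r β L (a β) f g h|)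
    (hIRon : ∃ (c₁ β₂ : ℝ) (S₁ : ℝ → ℕ), 0 < c₁ ∧ ∀ A B : YMSpecies G, ∃ C : ℝ, ∀ β ∈ Bset, β₂ ≤ β →
      ∀ S n : ℕ, S₁ β ≤ S → n ≤ S →
        |latticeConnectedCorr r.ρ β (2 * S + 1) A.F B.F n| ≤ C * Real.exp (-(c₁ * a β * n)))
    (hROT : ROT G r a) :
    ∃ (sch : SpeciesScheme (YMSpecies G)) (T : OSData (YMSpecies G) 4),
      (∀ k, sch.a k = a (sch.β k)) ∧ sch.HasWeakCouplingLimit ∧ IsYangMillsFor r sch T ∧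
        T.IsNontrivial r.curvature ∧ T.IsNonGaussian r.curvature ∧
        ∃ Δ > 0, T.HasMassGap Δ ∧ HasLatticeMassGap r sch Δ := by
  refine osDataWithGap_of_legs_germ_subseqNT r a hapos ha0 hUV Bset hBcof hNTsub hIRon
    fun sch S₁ Tq K b₀ g hB hdens => ?_
  obtain ⟨⟨hunits, -, -, hβ, -, -, -, -, -, -, -, -, -, -, -, -, hranges, -⟩, -⟩ := id hB
  obtain ⟨r₀, hr₀, hW⟩ := hROT sch hunits hβ hranges
  exact germRotAt_of_latticeWardAt r a sch S₁ Tq K b₀ g hB hdens hr₀ hW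

end OneGroup

/-- **`YangMills ⇐ UV ∧ ROT ∧ (IR♭ ∧ NT♭ on one cofinal coupling set)` — the summit from the SUBSEQUENTIAL non-triviality
leg.**  For every compact simple `G` SOME `r`, SOME positive unit map `a → 0`, the legs `UV = MomentBounds6`,
`ROT = LatticeRotWard` as in the tree bridge, and on SOME cofinal set of couplings `Bset` BOTH the `GapInUnits` family (one
rate `c₁`, species-uniform constants) AND NT's two floors in the weak form «one positive-time `v`, `ε > 0`, three
pairwise-disjointly supported `f, g, h`, `ε' > 0`, and at every `β ∈ Bset` both `ε ≤ Q2 G r β L (a β) (θv) v` and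
`ε' ≤ |Q3 G r β L (a β) f g h|` on tori `L` of UNBOUNDED size».  Conclusion: the tree's `_root_.YangMills` literally.
(`LowerBounds G r a` gives the NT clause on `Bset = [max β₅ β₆, ∞)` by `subseqFloors_of_lowerBounds`; with that and
`Bset = univ` for IR this is the tree's `yangMills_of_legs`.) [folklore] -/
theorem yangMills_of_subseqNTLegs
    (h : ∀ (G : Type) [Group G] [TopologicalSpace G] [IsTopologicalGroup G] [CompactSpace G],
      IsCompactSimpleLieGroup G → letI : MeasurableSpace G := borel G; haveI : BorelSpace G := ⟨rfl⟩;
      ∃ (r : LatticeRep G) (a : ℝ → ℝ), (∀ β, 0 < a β) ∧ Tendsto a atTop (𝓝 0) ∧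
        UV G r a ∧ ROT G r a ∧
        ∃ Bset : Set ℝ, (∀ x : ℝ, ∃ β ∈ Bset, x ≤ β) ∧
          (∃ (c₁ β₂ : ℝ) (S₁ : ℝ → ℕ), 0 < c₁ ∧ ∀ A B : YMSpecies G, ∃ C : ℝ, ∀ β ∈ Bset, β₂ ≤ β →
            ∀ S n : ℕ, S₁ β ≤ S → n ≤ S →
              |latticeConnectedCorr r.ρ β (2 * S + 1) A.F B.F n| ≤ C * Real.exp (-(c₁ * a β * n))) ∧
          (∃ (v : 𝓢(E4, ℝ)) (ε : ℝ) (f g h : 𝓢(E4, ℝ)) (ε' : ℝ),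
            tsupport (v : E4 → ℝ) ⊆ {y : E4 | 0 < y 0} ∧ 0 < ε ∧
            Disjoint (tsupport f) (tsupport g) ∧ Disjoint (tsupport g) (tsupport h) ∧
            Disjoint (tsupport f) (tsupport h) ∧ 0 < ε' ∧
            ∀ β ∈ Bset, ∀ D : ℕ, ∃ L : ℕ, D ≤ L ∧
              ε ≤ Q2 G r β L (a β) (thetaTest 4 v) v ∧ ε' ≤ |Q3 G r β L (a β) f g h|)) :
    YangMills := by
  intro G _ _ _ _ hG
  letI : MeasurableSpace G := borel G
  haveI : BorelSpace G := ⟨rfl⟩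
  obtain ⟨r, a, hapos, ha0, hUV, hROT, ⟨Bset, hBcof, hIRon, hNTsub⟩⟩ := h G hG
  obtain ⟨sch, T, -, hβ, hYM, hnt, hng, Δ, hΔ, hgap, hlat⟩ :=
    osDataWithGap_of_subseqNTLegs r a hapos ha0 hUV Bset hBcof hNTsub hIRon hROT
  exact ⟨r, sch, T, hβ, hYM, hnt, hng, Δ, hΔ, hgap, hlat⟩

end Summit.QuantumFields.YangMills.Cruxes.OSLegsAtWeakCouplingC.Y2Bridge

/-! ## §2 The NT-side dictionary: the typed leaf gives the subsequential floors; set-free reading; stability -/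

namespace Summit.QuantumFields.YangMills.Cruxes.NT.Subsequential

section Dictionary

variable {G : Type} [Group G] [TopologicalSpace G] [IsTopologicalGroup G] [CompactSpace G]
  [MeasurableSpace G] [BorelSpace G]

/-- **The typed leaf's floors give the subsequential floors** on the cofinal set `[max β₅ β₆, ∞)`: at every such coupling
and for every volume demand `D`, the torus `L = max D ⌈max Λ₅ Λ₆ / a β⌉` carries both floors (`a β > 0`). [folklore] -/
theorem subseqFloors_of_lowerBounds (r : LatticeRep G) {a : ℝ → ℝ} (hapos : ∀ β, 0 < a β)
    (hLB : LowerBounds G r a) :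
    ∃ B₀ : ℝ, ∃ (v : 𝓢(E4, ℝ)) (ε : ℝ) (f g h : 𝓢(E4, ℝ)) (ε' : ℝ),
      tsupport (v : E4 → ℝ) ⊆ {y : E4 | 0 < y 0} ∧ 0 < ε ∧
      Disjoint (tsupport f) (tsupport g) ∧ Disjoint (tsupport g) (tsupport h) ∧ Disjoint (tsupport f) (tsupport h) ∧
      0 < ε' ∧ ∀ β ∈ Set.Ici B₀, ∀ D : ℕ, ∃ L : ℕ, D ≤ L ∧
        ε ≤ Q2 G r β L (a β) (thetaTest 4 v) v ∧ ε' ≤ |Q3 G r β L (a β) f g h| := by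
  obtain ⟨⟨v, ε, β₅, Λ₅, hv, hε, HQ2⟩, ⟨f, g, h, ε', β₆, Λ₆, hfg, hgh, hfh, hε', HQ3⟩⟩ := hLB
  refine ⟨max β₅ β₆, v, ε, f, g, h, ε', hv, hε, hfg, hgh, hfh, hε', fun β hβ D => ?_⟩
  rw [Set.mem_Ici, max_le_iff] at hβ
  refine ⟨max D ⌈max Λ₅ Λ₆ / a β⌉₊, le_max_left _ _, ?_, ?_⟩
  · refine HQ2 β hβ.1 _ ?_
    have h1 : max Λ₅ Λ₆ / a β ≤ ((max D ⌈max Λ₅ Λ₆ / a β⌉₊ : ℕ) : ℝ) :=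
      (Nat.le_ceil _).trans (by exact_mod_cast le_max_right _ _)
    rw [div_le_iff₀ (hapos β)] at h1
    linarith [le_max_left Λ₅ Λ₆, mul_comm (((max D ⌈max Λ₅ Λ₆ / a β⌉₊ : ℕ) : ℝ)) (a β)]
  · refine HQ3 β hβ.2 _ ?_
    have h1 : max Λ₅ Λ₆ / a β ≤ ((max D ⌈max Λ₅ Λ₆ / a β⌉₊ : ℕ) : ℝ) :=
      (Nat.le_ceil _).trans (by exact_mod_cast le_max_right _ _)
    rw [div_le_iff₀ (hapos β)] at h1
    linarith [le_max_right Λ₅ Λ₆, mul_comm (((max D ⌈max Λ₅ Λ₆ / a β⌉₊ : ℕ) : ℝ)) (a β)]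

/-- `[B₀, ∞)` is a cofinal set of couplings. [folklore] -/
theorem cofinal_Ici (B₀ : ℝ) : ∀ x : ℝ, ∃ β ∈ Set.Ici B₀, x ≤ β :=
  fun x => ⟨max x B₀, Set.mem_Ici.2 (le_max_right _ _), le_max_left _ _⟩

/-- **The tree bridge as a special case**: `yangMills_of_legs`' hypothesis (`UV ∧ NT ∧ IR ∧ ROT` with `NT = LowerBounds`,
`IR = GapInUnits` at all large couplings) implies the subsequential hypothesis of `yangMills_of_subseqNTLegs` on
`Bset = [max β₅ β₆, ∞)` — so nothing is lost by the re-typing. [folklore] -/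
theorem yangMills_of_legs_via_subseq
    (h : ∀ (G : Type) [Group G] [TopologicalSpace G] [IsTopologicalGroup G] [CompactSpace G],
      IsCompactSimpleLieGroup G → letI : MeasurableSpace G := borel G; haveI : BorelSpace G := ⟨rfl⟩;
      ∃ (r : LatticeRep G) (a : ℝ → ℝ), (∀ β, 0 < a β) ∧ Tendsto a atTop (𝓝 0) ∧
        OSLegsAtWeakCouplingC.Y2Bridge.UV G r a ∧ OSLegsAtWeakCouplingC.Y2Bridge.NT G r a ∧
        OSLegsAtWeakCouplingC.Y2Bridge.IR G r a ∧ OSLegsAtWeakCouplingC.Y2Bridge.ROT G r a) :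
    YangMills := by
  refine OSLegsAtWeakCouplingC.Y2Bridge.yangMills_of_subseqNTLegs fun G _ _ _ _ hG => ?_
  letI : MeasurableSpace G := borel G
  haveI : BorelSpace G := ⟨rfl⟩
  obtain ⟨r, a, hapos, ha0, hUV, hNT, hIR, hROT⟩ := h G hG
  obtain ⟨B₀, hsub⟩ := subseqFloors_of_lowerBounds r hapos hNT
  refine ⟨r, a, hapos, ha0, hUV, hROT, Set.Ici B₀, cofinal_Ici B₀, ?_, hsub⟩
  exact OSLegsAtWeakCouplingC.Y2Bridge.gapOn_mono r a (Set.subset_univ _)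
    (OSLegsAtWeakCouplingC.Y2Bridge.gapOn_univ_of_gapInUnits r a hIR)

end Dictionary

/-! ### Set-free reading and stability (pure logic over predicates `P Q : ℝ → ℕ → Prop` of a coupling and a torus size) -/

section Logic

variable (P Q : ℝ → ℕ → Prop)

/-- **Set-free reading.**  «`P` holds at every coupling of some cofinal set, on tori of unbounded size» ↔ «for every coupling
threshold `B` and every volume demand `D : ℝ → ℕ` some `β ≥ B` and some `L ≥ D β` satisfy `P β L`». [folklore] -/
theorem exists_cofinal_unbounded_iff_forall_demand :
    (∃ Bset : Set ℝ, (∀ x : ℝ, ∃ β ∈ Bset, x ≤ β) ∧ ∀ β ∈ Bset, ∀ D : ℕ, ∃ L : ℕ, D ≤ L ∧ P β L) ↔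
      ∀ (B : ℝ) (D : ℝ → ℕ), ∃ β : ℝ, B ≤ β ∧ ∃ L : ℕ, D β ≤ L ∧ P β L := by
  constructor
  · rintro ⟨Bset, hcof, hP⟩ B D
    obtain ⟨β, hβ, hBβ⟩ := hcof B
    obtain ⟨L, hL, hPL⟩ := hP β hβ (D β)
    exact ⟨β, hBβ, L, hL, hPL⟩
  · intro h
    refine ⟨{β | ∀ D : ℕ, ∃ L : ℕ, D ≤ L ∧ P β L}, fun x => ?_, fun β hβ D => hβ D⟩
    by_contra hx
    -- every `β ≥ x` has a volume bound `D β` beyond which `P β` fails; feed that demand to `h`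
    have hD : ∀ β : ℝ, ∃ D : ℕ, x ≤ β → ∀ L : ℕ, D ≤ L → ¬ P β L := by
      intro β
      by_cases hβ : x ≤ β
      · by_contra hall
        refine hx ⟨β, fun D => ?_, hβ⟩
        by_contra hnone
        exact hall ⟨D, fun _ L hL hPL => hnone ⟨L, hL, hPL⟩⟩
      · exact ⟨0, fun h' => absurd h' hβ⟩
    choose D hD using hD
    obtain ⟨β, hβ, L, hL, hPL⟩ := h x D
    exact hD β hβ L hL hPL

/-- **Stability under pointwise disjunction.**  If for every threshold and every volume demand some admissible `(β, L)`
carries `P β L ∨ Q β L`, then the same holds for `P` alone or for `Q` alone (if both failed, the pointwise maximum of the two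
refuting demands would refute the disjunction).  The typed form «`∀ β ≥ β₅, ∀ L ≥ Λ/a β`» has no such property. [folklore] -/
theorem forall_demand_or
    (h : ∀ (B : ℝ) (D : ℝ → ℕ), ∃ β : ℝ, B ≤ β ∧ ∃ L : ℕ, D β ≤ L ∧ (P β L ∨ Q β L)) :
    (∀ (B : ℝ) (D : ℝ → ℕ), ∃ β : ℝ, B ≤ β ∧ ∃ L : ℕ, D β ≤ L ∧ P β L) ∨
      (∀ (B : ℝ) (D : ℝ → ℕ), ∃ β : ℝ, B ≤ β ∧ ∃ L : ℕ, D β ≤ L ∧ Q β L) := by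
  by_contra hne
  push Not at hne
  obtain ⟨⟨B₁, D₁, h₁⟩, ⟨B₂, D₂, h₂⟩⟩ := hne
  obtain ⟨β, hβ, L, hL, hPQ⟩ := h (max B₁ B₂) (fun β => max (D₁ β) (D₂ β))
  rcases hPQ with hP | hQ
  · exact h₁ β (le_of_max_le_left hβ) L (le_of_max_le_left hL) hP
  · exact h₂ β (le_of_max_le_right hβ) L (le_of_max_le_right hL) hQ

/-- **Per-coupling volume thresholds suffice**: «for all `β ≥ B₀` there is `L₀` with `P β L` for all `L ≥ L₀`» (no uniformity
of `L₀` in `β`, unlike the typed leaf's `L ≥ Λ/a β`) gives the subsequential form on `Bset = [B₀, ∞)`. [folklore] -/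
theorem subseq_of_thresholds {B₀ : ℝ} (h : ∀ β : ℝ, B₀ ≤ β → ∃ L₀ : ℕ, ∀ L : ℕ, L₀ ≤ L → P β L) :
    ∃ Bset : Set ℝ, (∀ x : ℝ, ∃ β ∈ Bset, x ≤ β) ∧ ∀ β ∈ Bset, ∀ D : ℕ, ∃ L : ℕ, D ≤ L ∧ P β L := by
  refine ⟨Set.Ici B₀, cofinal_Ici B₀, fun β hβ D => ?_⟩
  obtain ⟨L₀, hL₀⟩ := h β (Set.mem_Ici.1 hβ)
  exact ⟨max D L₀, le_max_left _ _, hL₀ _ (le_max_right _ _)⟩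

/-- **Cofinal sequences suffice**: floors along a sequence of couplings `b k → ∞`, each on tori of unbounded size, give the
subsequential form on `Bset = range b`. [folklore] -/
theorem subseq_of_seq {b : ℕ → ℝ} (hb : Tendsto b atTop atTop)
    (h : ∀ k : ℕ, ∀ D : ℕ, ∃ L : ℕ, D ≤ L ∧ P (b k) L) :
    ∃ Bset : Set ℝ, (∀ x : ℝ, ∃ β ∈ Bset, x ≤ β) ∧ ∀ β ∈ Bset, ∀ D : ℕ, ∃ L : ℕ, D ≤ L ∧ P β L := by
  refine ⟨Set.range b, fun x => ?_, ?_⟩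
  · obtain ⟨k, hk⟩ := (hb.eventually_ge_atTop x).exists
    exact ⟨b k, Set.mem_range_self k, hk⟩
  · rintro β ⟨k, rfl⟩ D
    exact h k D

/-- **Coupling windows feed the subsequential form only when the selected coupling does not depend on the torus.**  If above
every threshold some coupling `γ` carries `P γ L` on tori of unbounded size, the subsequential form holds (`Bset` = the set
of such `γ`). [folklore] -/
theorem subseq_of_window_uniform (h : ∀ B : ℝ, ∃ γ : ℝ, B ≤ γ ∧ ∀ D : ℕ, ∃ L : ℕ, D ≤ L ∧ P γ L) :
    ∃ Bset : Set ℝ, (∀ x : ℝ, ∃ β ∈ Bset, x ≤ β) ∧ ∀ β ∈ Bset, ∀ D : ℕ, ∃ L : ℕ, D ≤ L ∧ P β L := by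
  refine ⟨{γ | ∀ D : ℕ, ∃ L : ℕ, D ≤ L ∧ P γ L}, fun x => ?_, fun β hβ D => hβ D⟩
  obtain ⟨γ, hγ, hP⟩ := h x
  exact ⟨γ, hP, hγ⟩

/-- **… but NOT when it may depend on the torus** (the shape of the tree's octave laws
`…NTCouplingSumRuleOctaves.exists_sum_torusCov_dens_ge_octave`: `∀ L, ∀ β ≥ β₀, ∃ γ ∈ [β, Mβ], P γ L`).  Witness:
`P γ L :↔ γ = ⌈·⌉-integer + 1/(L+2)`; every window `[β, 2β]`, `β ≥ 2`, contains such a `γ` for every `L`, yet no coupling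
is good for two different tori. [folklore] -/
theorem not_subseq_of_octaveShape :
    ∃ P : ℝ → ℕ → Prop, (∀ L : ℕ, ∀ β : ℝ, 2 ≤ β → ∃ γ ∈ Set.Icc β (2 * β), P γ L) ∧
      ¬ ∃ Bset : Set ℝ, (∀ x : ℝ, ∃ β ∈ Bset, x ≤ β) ∧ ∀ β ∈ Bset, ∀ D : ℕ, ∃ L : ℕ, D ≤ L ∧ P β L := by
  refine ⟨fun γ L => ∃ n : ℕ, γ = n + 1 / ((L : ℝ) + 2), fun L β hβ => ?_, ?_⟩
  · have hfrac : 1 / ((L : ℝ) + 2) ≤ 1 / 2 :=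
      one_div_le_one_div_of_le two_pos (by linarith [(Nat.cast_nonneg L : (0 : ℝ) ≤ L)])
    have hfrac0 : 0 < 1 / ((L : ℝ) + 2) := by positivity
    refine ⟨⌈β⌉₊ + 1 / ((L : ℝ) + 2), ⟨?_, ?_⟩, ⌈β⌉₊, rfl⟩
    · linarith [Nat.le_ceil β]
    · have h1 : (⌈β⌉₊ : ℝ) < β + 1 := Nat.ceil_lt_add_one (by linarith)
      linarith
  · rintro ⟨Bset, hcof, hP⟩
    obtain ⟨γ, hγ, -⟩ := hcof 0
    -- two different good tori for the same coupling `γ`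
    obtain ⟨L₁, -, n₁, h₁⟩ := hP γ hγ 0
    obtain ⟨L₂, hL₂, n₂, h₂⟩ := hP γ hγ (L₁ + 1)
    have hL₁ : (0 : ℝ) < (L₁ : ℝ) + 2 := by positivity
    have hL₂' : (0 : ℝ) < (L₂ : ℝ) + 2 := by positivity
    have hf₁ : 0 < 1 / ((L₁ : ℝ) + 2) := by positivity
    have hf₂ : 0 < 1 / ((L₂ : ℝ) + 2) := by positivity
    have hf₁' : 1 / ((L₁ : ℝ) + 2) < 1 := by rw [div_lt_one hL₁]; linarith [(Nat.cast_nonneg L₁ : (0 : ℝ) ≤ L₁)]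
    have hf₂' : 1 / ((L₂ : ℝ) + 2) < 1 := by rw [div_lt_one hL₂']; linarith [(Nat.cast_nonneg L₂ : (0 : ℝ) ≤ L₂)]
    -- the integer parts agree
    have hn : n₁ = n₂ := by
      have h12 : (n₁ : ℝ) + 1 / ((L₁ : ℝ) + 2) = n₂ + 1 / ((L₂ : ℝ) + 2) := h₁.symm.trans h₂
      have hlt₁ : (n₁ : ℝ) < n₂ + 1 := by linarith
      have hlt₂ : (n₂ : ℝ) < n₁ + 1 := by linarith
      have := (show n₁ < n₂ + 1 by exact_mod_cast hlt₁)
      have := (show n₂ < n₁ + 1 by exact_mod_cast hlt₂)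
      omega
    subst hn
    have hfeq : 1 / ((L₁ : ℝ) + 2) = 1 / ((L₂ : ℝ) + 2) := by linarith
    rw [div_eq_div_iff hL₁.ne' hL₂'.ne', one_mul, one_mul] at hfeq
    have : (L₂ : ℝ) = L₁ := by linarith
    have hLL : L₂ = L₁ := by exact_mod_cast this
    omega

end Logic

end Summit.QuantumFields.YangMills.Cruxes.NT.Subsequential

end
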